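import Summits.QuantumFields.YangMills.Theorems.LuscherReductionTwistedTraceScalingBOStiffCoreCoeffMass
import Summits.QuantumFields.YangMills.Theorems.LuscherReductionTwistedTraceScalingBOStiffWeightTransport
import HarnessLib

/-!
# (B-ST) (L-4) INTEGRATED: the ground term of the core piece of record, `C = ∫_u (∫_x v₁(oT u x)·Θ·w̄ dπ)²/Z̄ dσ³ ≤ a·‖v‖²_w` for every `a > 0`, eventually in `β`
# (lane A of S-BASE, crux `TwistedTraceScaling` stmt-QuantumFields-20203, C4-CORE, the (B-ST) pen; HANDOFF-g21 STUB LEDGER (L-4))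

`…BOStiffCoreCoeffMass.core_coeff_sq_le_mul_fibreMass_one` bounds the squared fibrewise ground coefficient of the core piece `v₁ = 𝟙_{(S₂∪S₃)ᶜ}·v` by `a·Z̄·n_u(v)²`
(`Z̄ = fibreMass L (softWeight χ) Ω_c 1`, `n_u(v)² = ∫_x v(oT u x)²·softWeight χ (oT u x) dπ`) for every slow `u`.  Dividing by `Z̄` and integrating over `u ∈ SU(2)³` gives exactly the
`C`-term of `…BOStiffSlowAssembly.form_le_of_product_near` (`(U,ν) = (SU(2)³, σ³)`, `(X,μ) = (Bal, π)`, `w = softWeight χ ∘ orthoTube 1`, `Θ = Ω_c ∘ linkEmbed`, `Z = Z̄`):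
★★★ `core_coeff_integral_le` — `∃ M₀ ≥ 2, ∀ M ≥ M₀, ∀ a > 0, ∀ᶠ β, ∀ v` bounded measurable supported in `{recordChi L s 43 M β ≠ 0}` with `∀ u, fibreInner L (softWeight χ) Ω_c v u = 0`:
`∫_u (∫_x v₁(oT u x)·Ω_c(x̂)·softWeight χ (oT 1 x) dπ)²/Z̄ dσ³ ≤ a·tubeNormSq (softWeight χ) v` (`∫_u n_u(v)² dσ³ = ‖v‖²_w` by the tube disintegration
`…BOStiffWeightTransport.tubeNormSq_eq_tube_integral`, support in the tube set by `recordChi_support`).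
HONEST FRAMING: bookkeeping for a stub of a child of the CONDITIONAL route R2b1; (B-ST) OPEN; C4-CORE OPEN; not infinite volume, not a gap, not Clay.
-/

set_option autoImplicit false

noncomputable section

open MeasureTheory Filter Topology Real
open scoped BigOperators
open Literature.MathematicalPhysics.QuantumFieldTheory
open Literature.MathematicalPhysics.QuantumLattice

namespace Summit.QuantumFields.YangMills.Theorems.FemtoTransferGap.TwoLattice.ConstTube

open Summit.QuantumFields.YangMills.Theorems.FemtoTransferGap
open Summit.QuantumFields.YangMills.Theorems.FemtoTransferGap.TwoLattice
open Summit.QuantumFields.YangMills.Theorems.FemtoTransferGap.TwoLattice.Avg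
open Summit.QuantumFields.YangMills.Theorems.FemtoTransferGap.TwoLattice.Stiff
open Summit.QuantumFields.YangMills.Theorems.FemtoTransferGap.TwoLattice.GnChart
open Summit.QuantumFields.YangMills.Theorems.FemtoTransferGap.TwoLattice.Cov
open Summit.QuantumFields.YangMills.Theorems.FemtoTransferGap.TwoLattice.Toron

variable {L : ℕ} [NeZero L]

set_option maxHeartbeats 1600000 in
-- long record expressions.
/-- ★★★ **THE GROUND TERM OF THE CORE PIECE OF RECORD, INTEGRATED OVER THE SLOW VARIABLE** (see the module docstring). [cite: Luscher1983, §3] -/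
theorem core_coeff_integral_le (hLz : Nonempty (NzSite L)) (hL : 2 ≤ L) {s : ℝ} (hs : 0 < s) (hs3 : s ≤ 1 / 3) :
    ∃ M₀ : ℝ, 2 ≤ M₀ ∧ ∀ M : ℝ, M₀ ≤ M → ∀ a : ℝ, 0 < a → ∀ᶠ β : ℝ in atTop,
      ∀ v : GaugeConfig 3 L SU2 → ℝ, Measurable v → (∃ C : ℝ, ∀ U, |v U| ≤ C) → (∀ U, v U ≠ 0 → recordChi L s 43 M β U ≠ 0) →
        (∀ u : GaugeConfig 3 1 SU2, fibreInner L (softWeight (recordChi L s 43 M β)) (fun x : LinkSpace L => {x : LinkSpace L | linkCurry x ∈ capBalancedSet L}.indicator (fun _ => (1 : ℝ)) x *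
          frozenProfile L (fun β' => stiffGaussExp L (β' / 2) β') (fun β' => min (1 / 40) (powScale (1 / 2) β' * btLog β')) β x) v u = 0) →
        ∫ u, (∫ x, ({U : GaugeConfig 3 L SU2 | powScale 1 β * btLog β < ‖(gaugeModes L).starProjection (relLinkVec L U)‖} ∪
                  {U : GaugeConfig 3 L SU2 | min (1 / 40) (powScale (1 / 2) β * btLog β) / 2 < ‖relLinkVec L U‖})ᶜ.indicator v (orthoTube L u x) *
              ({x : LinkSpace L | linkCurry x ∈ capBalancedSet L}.indicator (fun _ => (1 : ℝ)) (linkEmbed L x) *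
                frozenProfile L (fun β' => stiffGaussExp L (β' / 2) β') (fun β' => min (1 / 40) (powScale (1 / 2) β' * btLog β')) β (linkEmbed L x)) *
              softWeight (recordChi L s 43 M β) (orthoTube L 1 x) ∂orthoTransverse L) ^ 2 /
            fibreMass L (softWeight (recordChi L s 43 M β)) (fun x : LinkSpace L => {x : LinkSpace L | linkCurry x ∈ capBalancedSet L}.indicator (fun _ => (1 : ℝ)) x *
              frozenProfile L (fun β' => stiffGaussExp L (β' / 2) β') (fun β' => min (1 / 40) (powScale (1 / 2) β' * btLog β')) β x) 1 ∂configMeasure SU2 1 ≤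
          a * tubeNormSq (softWeight (recordChi L s 43 M β)) v := by
  haveI := isFiniteMeasure_orthoTransverse L
  obtain ⟨M₀, hM₀, H⟩ := core_coeff_sq_le_mul_fibreMass_one (L := L) hLz hL hs hs3
  refine ⟨M₀, hM₀, fun M hM a ha => ?_⟩
  have hM0 : 0 ≤ M := le_trans (by norm_num) (hM₀.trans hM)
  filter_upwards [H M hM a ha, recordChi_support (L := L) hs hM0] with β hcore hsupp v hv hC hvs horth
  obtain ⟨Cv, hCv⟩ := hC
  set χ := recordChi L s 43 M β with hχdef
  set Ω : LinkSpace L → ℝ := fun x => {x : LinkSpace L | linkCurry x ∈ capBalancedSet L}.indicator (fun _ => (1 : ℝ)) x *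
    frozenProfile L (fun β' => stiffGaussExp L (β' / 2) β') (fun β' => min (1 / 40) (powScale (1 / 2) β' * btLog β')) β x with hΩdef
  set Z : ℝ := fibreMass L (softWeight χ) Ω 1 with hZdef
  set n2 : GaugeConfig 3 1 SU2 → ℝ := fun u => ∫ x, v (orthoTube L u x) ^ 2 * softWeight χ (orthoTube L u x) ∂orthoTransverse L with hn2def
  obtain ⟨hwm, hwb, hw0, -⟩ := softWeight_recordChi_props (L := L) s 43 M β
  -- pointwise in `u`: `(…)²/Z̄ ≤ a·n_u²`
  have hpt : ∀ u : GaugeConfig 3 1 SU2,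
      (∫ x, ({U : GaugeConfig 3 L SU2 | powScale 1 β * btLog β < ‖(gaugeModes L).starProjection (relLinkVec L U)‖} ∪
                {U : GaugeConfig 3 L SU2 | min (1 / 40) (powScale (1 / 2) β * btLog β) / 2 < ‖relLinkVec L U‖})ᶜ.indicator v (orthoTube L u x) *
            Ω (linkEmbed L x) * softWeight χ (orthoTube L 1 x) ∂orthoTransverse L) ^ 2 / Z ≤ a * n2 u := by
    intro u
    have h := hcore u v hv ⟨Cv, hCv⟩ hvs (horth u)
    have hn0 : 0 ≤ n2 u := integral_nonneg fun x => mul_nonneg (sq_nonneg _) (hw0 _)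
    by_cases hZ0 : Z ≤ 0
    · -- `Z ≥ 0` always; so `Z = 0` and the quotient vanishes
      have hZnn : 0 ≤ Z := by
        rw [hZdef]; unfold fibreMass; exact integral_nonneg fun x => mul_nonneg (sq_nonneg _) (hw0 _)
      have hZe : Z = 0 := le_antisymm hZ0 hZnn
      rw [hZe, div_zero]; exact mul_nonneg ha.le hn0
    · push Not at hZ0
      rw [div_le_iff₀ hZ0]
      calc _ ≤ a * Z * n2 u := h
        _ = a * n2 u * Z := by ring
  -- integrate over `u`: the upper function is bounded measurable, the lower nonnegative
  have hGm : Measurable fun p : GaugeConfig 3 1 SU2 × (Edge 3 L → Fin 3 → ℝ) => v (orthoTube L p.1 p.2) ^ 2 * softWeight χ (orthoTube L p.1 p.2) :=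
    ((hv.comp (measurable_orthoTube L)).pow_const 2).mul (hwm.comp (measurable_orthoTube L))
  have hGb : ∀ p : GaugeConfig 3 1 SU2 × (Edge 3 L → Fin 3 → ℝ), |v (orthoTube L p.1 p.2) ^ 2 * softWeight χ (orthoTube L p.1 p.2)| ≤
      Cv ^ 2 * Real.exp ((Fintype.card (Edge 3 L) : ℝ) / powScale 1 β ^ 2) := fun p => by
    rw [abs_mul, abs_pow]; exact mul_le_mul (pow_le_pow_left₀ (abs_nonneg _) (hCv _) 2) (hwb _) (abs_nonneg _) (sq_nonneg _)
  obtain ⟨hn2m, hn2b⟩ := StiffDoor.measurable_integral_fibre (κ := orthoTransverse L)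
    (F := fun p : GaugeConfig 3 1 SU2 × (Edge 3 L → Fin 3 → ℝ) => v (orthoTube L p.1 p.2) ^ 2 * softWeight χ (orthoTube L p.1 p.2)) hGm hGb
  have hn2i : Integrable n2 (configMeasure SU2 1) := integrable_of_measurable_abs_le _ hn2m fun u => hn2b u
  have hstep : ∫ u, (∫ x, ({U : GaugeConfig 3 L SU2 | powScale 1 β * btLog β < ‖(gaugeModes L).starProjection (relLinkVec L U)‖} ∪
                {U : GaugeConfig 3 L SU2 | min (1 / 40) (powScale (1 / 2) β * btLog β) / 2 < ‖relLinkVec L U‖})ᶜ.indicator v (orthoTube L u x) *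
            Ω (linkEmbed L x) * softWeight χ (orthoTube L 1 x) ∂orthoTransverse L) ^ 2 / Z ∂configMeasure SU2 1 ≤ ∫ u, a * n2 u ∂configMeasure SU2 1 := by
    refine integral_mono_of_nonneg (ae_of_all _ fun u => ?_) (hn2i.const_mul a) (ae_of_all _ hpt)
    have hZnn : 0 ≤ Z := by
      rw [hZdef]; unfold fibreMass; exact integral_nonneg fun x => mul_nonneg (sq_nonneg _) (hw0 _)
    exact div_nonneg (sq_nonneg _) hZnn
  -- `∫_u n_u² = ‖v‖²_w` by the tube disintegration
  have hv0 : ∀ U, U ∉ orthoTubeSet L → v U = 0 := fun U hU => by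
    by_contra h; exact hU (hsupp U (hvs U h)).2.2.1
  have hN : ∫ u, n2 u ∂configMeasure SU2 1 = tubeNormSq (softWeight χ) v := by
    rw [tubeNormSq_eq_tube_integral hwm hwb hv hCv hv0, integral_prod _ (integrable_of_measurable_abs_le _ hGm hGb)]
  calc _ ≤ ∫ u, a * n2 u ∂configMeasure SU2 1 := hstep
    _ = a * tubeNormSq (softWeight χ) v := by rw [integral_const_mul, hN]

end Summit.QuantumFields.YangMills.Theorems.FemtoTransferGap.TwoLattice.ConstTube

end
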